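import Mathlib.MeasureTheory.Integral.IntervalIntegral.FundThmCalculus
import Mathlib.Analysis.SpecialFunctions.Integrals.Basic
import HarnessLib

/-!
# Mean square over a window around a peak, from a uniform bound and a `1/|t - t₁|` decay

Topic `Literature/NumberTheory/LFunctions`.  Everything in this file is PROVED (real analysis, Mathlib only); no
definitions, no named facts.

In the proof of Matomäki–Radziwiłł–Tao 2015, Proposition A.3 (Appendix A) the range
`𝒯₀ ∪ 𝒯₁ = {t : |t - t₁| ≤ (log X)^{1/16}}` around the minimising twist `t₁` is handled by two pointwise bounds for
`φ(t) = |F(1+it)|`: a uniform one (`φ ≤ B`, Halász with the global minimum `M`) and a decaying one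
(`φ(t) ≤ D/|t - t₁| + E` for `|t - t₁| ≥ R`, Halász with `T = |t - t₁|/2`), integrated over
`|t - t₁| ≤ S` and `S ≤ |t - t₁| ≤ L` respectively ("Using the estimate `F(1+it) ≪ 1/|t-t₁|` for `t ∈ 𝒯₁`
and the estimate `F(1+it) ≪ e^{-M}M` … for `t ∈ 𝒯₀`").  For the block-RESTRICTED polynomial the uniform
bound is only `B ≍ (1 + M/2) e^{-M/2}` (`Halasz.Restricted.norm_restr_sum_le`), and the split point must be
chosen as `S ≍ D/B` rather than the printed `e^M/M`; this file records the resulting elementary inequality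
once and for all:

* `MeanSquareNearPeak.integral_sq_le_of_peak_decay` —
  `∫_{t₁-L}^{t₁+L} φ² ≤ 2 S B² + 4 D²/S + 4 L E²` for `0 < R ≤ S ≤ L`, `φ ≥ 0` continuous, `φ ≤ B`,
  `φ(t) ≤ D/|t - t₁| + E` (`|t - t₁| ≥ R`; `E` of either sign, only `E²` enters);
* `MeanSquareNearPeak.integral_sq_le_peak_decay_opt` — the choice `S = max R (D/B)` (`B > 0`, `D/B ≤ L`):
  `∫_{t₁-L}^{t₁+L} φ² ≤ 2 R B² + 6 D B + 4 L E²` — with `B ≍ (1+M) e^{-M/2}`, `D ≍ 1` this is the middle term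
  `(1 + M) e^{-M/2}` of the restricted-Halász form of Proposition A.3 (`MRT2015.PropA3With`,
  `MatomakiRadziwillTaoPropA3With.lean`).

## References
* K. Matomäki, M. Radziwiłł, T. Tao, Algebra & Number Theory 9 (2015), Appendix A, proof of Proposition A.3
  (the ranges `𝒯₀`, `𝒯₁`). [cite: MatomakiRadziwillTao2015, Appendix A, Proposition A.3 (proof)]
-/

noncomputable section

open MeasureTheory Set intervalIntegral Real

namespace Literature.NumberTheory.LFunctions

namespace MeanSquareNearPeak

/-- `∫_a^b du/u² = 1/a - 1/b` for `0 < a ≤ b`. [folklore] -/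
theorem integral_inv_sq {a b : ℝ} (ha : 0 < a) (hab : a ≤ b) :
    ∫ u in a..b, 1 / u ^ 2 = 1 / a - 1 / b := by
  have hmem : ∀ u ∈ uIcc a b, 0 < u := fun u hu => by
    rw [uIcc_of_le hab] at hu; exact ha.trans_le hu.1
  have hderiv : ∀ u ∈ uIcc a b, HasDerivAt (fun u : ℝ => -(1 / u)) (1 / u ^ 2) u := by
    intro u hu
    have hu0 : u ≠ 0 := (hmem u hu).ne'
    have h1 : HasDerivAt (fun u : ℝ => u⁻¹) (-(u ^ 2)⁻¹) u := hasDerivAt_inv hu0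
    have h2 := h1.neg
    refine (h2.congr_deriv (by ring)).congr_of_eventuallyEq ?_
    exact Filter.Eventually.of_forall fun v => by simp [one_div]
  have hcont : ContinuousOn (fun u : ℝ => 1 / u ^ 2) (uIcc a b) := by
    refine ContinuousOn.div continuousOn_const (continuousOn_id.pow 2) fun u hu => ?_
    exact pow_ne_zero 2 (hmem u hu).ne'
  rw [intervalIntegral.integral_eq_sub_of_hasDerivAt hderiv hcont.intervalIntegrable]
  ring

/-- The decaying side: for `φ ≥ 0` continuous with `φ(t) ≤ D/|t - t₁| + E` when `|t - t₁| ≥ R`, and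
`0 < R ≤ S ≤ L`, `∫_{t₁+S}^{t₁+L} φ² ≤ 2 D²/S + 2 L E²` (`(x + y)² ≤ 2x² + 2y²`, `∫_S^L du/u² ≤ 1/S`). [folklore] -/
theorem integral_sq_right_le {φ : ℝ → ℝ} (hφc : Continuous φ) (hφ0 : ∀ t, 0 ≤ φ t)
    {t₁ D E R S L : ℝ} (hD : 0 ≤ D) (hR : 0 < R) (hRS : R ≤ S) (hSL : S ≤ L)
    (hdecay : ∀ t, R ≤ |t - t₁| → φ t ≤ D / |t - t₁| + E) :
    ∫ t in (t₁ + S)..(t₁ + L), φ t ^ 2 ≤ 2 * D ^ 2 / S + 2 * L * E ^ 2 := by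
  have hS0 : 0 < S := hR.trans_le hRS
  have hL0 : 0 < L := hS0.trans_le hSL
  have hle : t₁ + S ≤ t₁ + L := by linarith
  -- pointwise majorant on `[t₁+S, t₁+L]`
  have hmaj : ∀ t ∈ Icc (t₁ + S) (t₁ + L), φ t ^ 2 ≤ 2 * D ^ 2 * (1 / (t - t₁) ^ 2) + 2 * E ^ 2 := by
    intro t ht
    have hdt : S ≤ t - t₁ := by linarith [ht.1]
    have hpos : 0 < t - t₁ := hS0.trans_le hdt
    have habs : |t - t₁| = t - t₁ := abs_of_pos hpos
    have h1 : φ t ≤ D / (t - t₁) + E := by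
      have := hdecay t (by rw [habs]; linarith); rwa [habs] at this
    have h2 : 0 ≤ D / (t - t₁) := div_nonneg hD hpos.le
    have h3 : φ t ^ 2 ≤ (D / (t - t₁) + E) ^ 2 := pow_le_pow_left₀ (hφ0 t) h1 2
    have h4 : (D / (t - t₁) + E) ^ 2 ≤ 2 * (D / (t - t₁)) ^ 2 + 2 * E ^ 2 := by
      nlinarith [sq_nonneg (D / (t - t₁) - E)]
    have h5 : (D / (t - t₁)) ^ 2 = D ^ 2 * (1 / (t - t₁) ^ 2) := by
      rw [div_pow]; ring
    linarith [h3, h4, h5.le, h5.ge]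
  -- integrability
  have hi1 : IntervalIntegrable (fun t => φ t ^ 2) volume (t₁ + S) (t₁ + L) :=
    (hφc.pow 2).intervalIntegrable _ _
  have hcont2 : ContinuousOn (fun t : ℝ => 2 * D ^ 2 * (1 / (t - t₁) ^ 2) + 2 * E ^ 2) (uIcc (t₁ + S) (t₁ + L)) := by
    refine ContinuousOn.add (continuousOn_const.mul (ContinuousOn.div continuousOn_const
      ((continuousOn_id.sub continuousOn_const).pow 2) fun t ht => ?_)) continuousOn_const
    rw [uIcc_of_le hle] at ht
    exact pow_ne_zero 2 (by linarith [ht.1] : t - t₁ ≠ 0)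
  have hi2 : IntervalIntegrable (fun t : ℝ => 2 * D ^ 2 * (1 / (t - t₁) ^ 2) + 2 * E ^ 2) volume (t₁ + S) (t₁ + L) :=
    hcont2.intervalIntegrable
  have hmono := intervalIntegral.integral_mono_on hle hi1 hi2 hmaj
  refine hmono.trans ?_
  -- compute the majorant's integral
  have hi3 : IntervalIntegrable (fun t : ℝ => 1 / (t - t₁) ^ 2) volume (t₁ + S) (t₁ + L) := by
    refine ContinuousOn.intervalIntegrable ?_
    refine ContinuousOn.div continuousOn_const ((continuousOn_id.sub continuousOn_const).pow 2) fun t ht => ?_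
    rw [uIcc_of_le hle] at ht
    exact pow_ne_zero 2 (by linarith [ht.1] : t - t₁ ≠ 0)
  rw [intervalIntegral.integral_add (hi3.const_mul _) (intervalIntegrable_const),
    intervalIntegral.integral_const_mul, intervalIntegral.integral_const]
  have hshift : ∫ t in (t₁ + S)..(t₁ + L), 1 / (t - t₁) ^ 2 = ∫ u in S..L, 1 / u ^ 2 := by
    rw [intervalIntegral.integral_comp_sub_right (fun u => 1 / u ^ 2) t₁]
    congr 1 <;> ring
  rw [hshift, integral_inv_sq hS0 hSL]
  have h1 : 1 / S - 1 / L ≤ 1 / S := by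
    have : 0 ≤ 1 / L := by positivity
    linarith
  have h2 : (t₁ + L - (t₁ + S)) • (2 * E ^ 2) ≤ 2 * L * E ^ 2 := by
    rw [smul_eq_mul]
    have : 0 ≤ S * E ^ 2 := by positivity
    nlinarith
  have h3 : 2 * D ^ 2 * (1 / S - 1 / L) ≤ 2 * D ^ 2 / S := by
    have h0 : 0 ≤ 2 * D ^ 2 := by positivity
    calc 2 * D ^ 2 * (1 / S - 1 / L) ≤ 2 * D ^ 2 * (1 / S) := mul_le_mul_of_nonneg_left h1 h0
      _ = 2 * D ^ 2 / S := by ring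
  linarith

/-- **Mean square near a peak.**  Let `φ ≥ 0` be continuous with `φ ≤ B` everywhere and
`φ(t) ≤ D/|t - t₁| + E` for `|t - t₁| ≥ R`; let `0 < R ≤ S ≤ L`.  Then
`∫_{t₁-L}^{t₁+L} φ(t)² dt ≤ 2 S B² + 4 D²/S + 4 L E²`
(the window `|t - t₁| ≤ S` by the uniform bound, the two sides by the decay).
[cite: MatomakiRadziwillTao2015, Appendix A, Proposition A.3 (proof)] -/
theorem integral_sq_le_of_peak_decay {φ : ℝ → ℝ} (hφc : Continuous φ) (hφ0 : ∀ t, 0 ≤ φ t)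
    {t₁ B D E R S L : ℝ} (hD : 0 ≤ D) (hR : 0 < R) (hRS : R ≤ S)
    (hSL : S ≤ L) (hpeak : ∀ t, φ t ≤ B) (hdecay : ∀ t, R ≤ |t - t₁| → φ t ≤ D / |t - t₁| + E) :
    ∫ t in (t₁ - L)..(t₁ + L), φ t ^ 2 ≤ 2 * S * B ^ 2 + 4 * D ^ 2 / S + 4 * L * E ^ 2 := by
  have hS0 : 0 < S := hR.trans_le hRS
  have hB0 : 0 ≤ B := (hφ0 t₁).trans (hpeak t₁)
  have hint : ∀ a b : ℝ, IntervalIntegrable (fun t => φ t ^ 2) volume a b := fun a b =>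
    (hφc.pow 2).intervalIntegrable _ _
  -- split `[t₁-L, t₁+L] = [t₁-L, t₁-S] ∪ [t₁-S, t₁+S] ∪ [t₁+S, t₁+L]`
  rw [← intervalIntegral.integral_add_adjacent_intervals (hint (t₁ - L) (t₁ - S)) (hint (t₁ - S) (t₁ + L)),
    ← intervalIntegral.integral_add_adjacent_intervals (hint (t₁ - S) (t₁ + S)) (hint (t₁ + S) (t₁ + L))]
  -- the middle: uniform bound
  have hmid : ∫ t in (t₁ - S)..(t₁ + S), φ t ^ 2 ≤ 2 * S * B ^ 2 := by
    have h1 : ∫ t in (t₁ - S)..(t₁ + S), φ t ^ 2 ≤ ∫ t in (t₁ - S)..(t₁ + S), B ^ 2 :=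
      intervalIntegral.integral_mono_on (by linarith) (hint _ _) intervalIntegrable_const
        fun t _ => pow_le_pow_left₀ (hφ0 t) (hpeak t) 2
    rw [intervalIntegral.integral_const, smul_eq_mul] at h1
    linarith [h1, show (t₁ + S - (t₁ - S)) * B ^ 2 = 2 * S * B ^ 2 by ring]
  -- the right side
  have hright := integral_sq_right_le hφc hφ0 hD hR hRS hSL hdecay (t₁ := t₁)
  -- the left side, by reflection `t ↦ 2t₁ - t`
  have hleft : ∫ t in (t₁ - L)..(t₁ - S), φ t ^ 2 ≤ 2 * D ^ 2 / S + 2 * L * E ^ 2 := by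
    set ψ : ℝ → ℝ := fun u => φ (2 * t₁ - u) with hψ
    have hψc : Continuous ψ := hφc.comp (continuous_const.sub continuous_id)
    have hψ0 : ∀ u, 0 ≤ ψ u := fun u => hφ0 _
    have hψdecay : ∀ u, R ≤ |u - t₁| → ψ u ≤ D / |u - t₁| + E := by
      intro u hu
      have e : |2 * t₁ - u - t₁| = |u - t₁| := by
        rw [show 2 * t₁ - u - t₁ = -(u - t₁) by ring, abs_neg]
      have := hdecay (2 * t₁ - u) (by rw [e]; exact hu)
      rwa [e] at this
    have h := integral_sq_right_le hψc hψ0 hD hR hRS hSL hψdecay (t₁ := t₁)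
    -- change of variables `t = 2t₁ - u`
    have hcv : ∫ u in (t₁ + S)..(t₁ + L), ψ u ^ 2 = ∫ t in (t₁ - L)..(t₁ - S), φ t ^ 2 := by
      have h1 := intervalIntegral.integral_comp_sub_left (fun t => φ t ^ 2) (2 * t₁) (a := t₁ + S) (b := t₁ + L)
      simp only [hψ] at h1 ⊢
      rw [h1, show 2 * t₁ - (t₁ + S) = t₁ - S by ring, show 2 * t₁ - (t₁ + L) = t₁ - L by ring]
    rw [← hcv]; exact h
  have hsum := add_le_add hleft (add_le_add hmid hright)
  refine hsum.trans (le_of_eq ?_)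
  ring

/-- **The optimised split.**  With `S = max R (D/B)` (`B > 0`, `D/B ≤ L`, `R ≤ L`):
`∫_{t₁-L}^{t₁+L} φ² ≤ 2 R B² + 6 D B + 4 L E²`.  In Proposition A.3 for block-restricted sums,
`B ≍ (1 + M/2) e^{-M/2}` (the uniform restricted-Halász bound), `D ≍ 1` (Halász's `1/T` term with
`T = |t - t₁|/2`), `R` absolute, `L = (log X)^{1/16}`, `E = o((log X)^{-1/32})`: the window contributes
`≪ (1 + M) e^{-M/2} + o(1)`. [cite: MatomakiRadziwillTao2015, Appendix A, Proposition A.3 (proof)] -/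
theorem integral_sq_le_peak_decay_opt {φ : ℝ → ℝ} (hφc : Continuous φ) (hφ0 : ∀ t, 0 ≤ φ t)
    {t₁ B D E R L : ℝ} (hB : 0 < B) (hD : 0 ≤ D) (hR : 0 < R) (hRL : R ≤ L)
    (hDBL : D / B ≤ L) (hpeak : ∀ t, φ t ≤ B) (hdecay : ∀ t, R ≤ |t - t₁| → φ t ≤ D / |t - t₁| + E) :
    ∫ t in (t₁ - L)..(t₁ + L), φ t ^ 2 ≤ 2 * R * B ^ 2 + 6 * D * B + 4 * L * E ^ 2 := by
  set S : ℝ := max R (D / B) with hS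
  have hRS : R ≤ S := le_max_left _ _
  have hSL : S ≤ L := max_le hRL hDBL
  have hS0 : 0 < S := hR.trans_le hRS
  have h := integral_sq_le_of_peak_decay hφc hφ0 hD hR hRS hSL hpeak hdecay (t₁ := t₁) (B := B)
  refine h.trans ?_
  -- `2 S B² ≤ 2 R B² + 2 D B` and `4 D²/S ≤ 4 D B`
  have h1 : 2 * S * B ^ 2 ≤ 2 * R * B ^ 2 + 2 * D * B := by
    have hSle : S ≤ R + D / B := by
      rcases le_total R (D / B) with h' | h'
      · rw [hS, max_eq_right h']; linarith
      · rw [hS, max_eq_left h']; have : 0 ≤ D / B := by positivity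
        linarith
    have hB2 : 0 ≤ 2 * B ^ 2 := by positivity
    calc 2 * S * B ^ 2 = S * (2 * B ^ 2) := by ring
      _ ≤ (R + D / B) * (2 * B ^ 2) := mul_le_mul_of_nonneg_right hSle hB2
      _ = 2 * R * B ^ 2 + 2 * D * B := by field_simp
  have h2 : 4 * D ^ 2 / S ≤ 4 * D * B := by
    have hDS : D / B ≤ S := le_max_right _ _
    -- `D ≤ S B`, so `D²/S ≤ D B`
    have hD' : D ≤ S * B := by rwa [div_le_iff₀ hB] at hDS
    rw [div_le_iff₀ hS0]
    have h0 : 0 ≤ 4 * D := by positivity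
    nlinarith [mul_le_mul_of_nonneg_left hD' h0]
  linarith

end MeanSquareNearPeak

end Literature.NumberTheory.LFunctions

end
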